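import Literature.Barriers.CriticalPhenomena.KozmaNachmiasLemma55BKR
import HarnessLib

/-!
# Kozma–Nachmias 2011, Lemma 5.5: `Σ_y P(E₁ ∩ E₂ ∩ E₃) ≥ c L² P(E₁)` for some auxiliary vertex `x'` — PROVED

Barrier catalogue `Literature/Barriers/CriticalPhenomena/` (D-0021), programme for the named fact
`KozmaNachmias2011_thm2` via `KozmaNachmias2011_lemma51` (`KozmaNachmiasTheorem2.lean`).

> **Lemma 5.5** (Kozma–Nachmias 2011, p. 401). There exists a constant `c > 0` and `K > 0` large
> enough such that for any `x ∈ ∂Q_j` there exists `x' ∈ (x + Q_K) ∖ Q_{j+K/2}` with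
> `Σ_{y ∈ x + Q_L} P(E₁ ∩ E₂ ∩ E₃) ≥ c L² P(E₁)`.

"We only require one such `x'` and choosing `x'` at random simplifies the proof" (Remark, p. 401):
the printed proof averages over `x'` in a cube of side of order `K` (Claim 5.4) and bounds
`E_{x'} Σ_y P(E₁ ∩ E₂ ∩ ¬E₃) ≤ C L² P(E₁) K^{6-d} log⁷ K` through the BK–Reimer step (5.8)
(`KozmaNachmiasLemma55BKR.lean`), the two-point sums (5.9)–(5.10), the regularity of `x` at the
large scales (5.11)–(5.12) and the randomisation at the small scales, and concludes with Lemma 5.3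
(`KozmaNachmiasLemma53.lean`). This file PROVES the lemma in that form:

* `auxRad K = ⌊(K+3)/4⌋`, `auxSet K x i σ` — OUR randomisation range for `x'`: the cube of radius
  `auxRad K` centred at `x + σ (K + auxRad K) e_i`, where `e_i` is the outward normal of the face of
  `Q_j` containing `x` (`x_i = σ j`); its points are within `2K` of `x` and at sup-distance `≥ K`
  from `Q_j` (the source uses `(x + K) + Q_{K/2}`; any cube of side `≍ K` at distance `≍ K` works);
* `sum_bkr_error_le` — the averaged error bound: for `δ > 0` and `K ≥ K₀(δ)`,
  `Σ_{x' ∈ auxSet} Σ_{w ∈ Q_L} Σ_{z ∈ Λ_N} P(E₁ ∩ {0 ↔ z}) τ(x',z) τ(z,x+w) ≤ δ L² |auxSet| P(E₁)`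
  uniformly in `N` (dyadic decomposition around `x'`, `tail_large` for `2^t ≥ K`, `tail_small` with the
  randomisation for `2^t < K`);
* **`KozmaNachmias2011_lemma55`** — Lemma 5.5 at `p = p_c`, `d > 6`, under `TwoPointBoundedRatio d`:
  for `K ≥ K₀`, `x ∈ ∂Q_j` on the face `x_i = σ j`, and `L ≥ 2K`, some `x' ∈ auxSet K x i σ` has
  `Σ_{w ∈ Q_L, x+w ∉ Q_j} P(E₁ ∩ E₂(x,x',x+w) ∩ E₃(x,x')) ≥ c L² P(E₁)`.

## References

* G. Kozma, A. Nachmias, *Arm exponents in high dimensional percolation*, J. Amer. Math. Soc. 24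
  (2011) 375–409: Claim 5.4, Lemma 5.5 and its proof ((5.8)–(5.12), pp. 401–403).
-/

noncomputable section

namespace Literature.Barriers.CriticalPhenomena

open _root_.MeasureTheory _root_.Filter _root_.Topology Finset Literature.Probability.LatticeModels
  Literature.Probability.Percolation Literature.Probability.Percolation.DCT16
open scoped Literature.Probability.LatticeModels Literature.Probability.Percolation

variable {d : ℕ}

/-! ### The randomisation range for `x'` -/

section AuxSet

/-- The radius `⌊(K+3)/4⌋` of the randomisation cube. [cite: KozmaNachmias2011, proof of Lemma 5.5 (p. 401: "x' uniform in (x+K)+Q_{K/2}")] -/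
def auxRad (K : ℕ) : ℕ := (K + 3) / 4

/-- **The randomisation range** `x + σ (K + auxRad K) e_i + Q_{auxRad K}` for the auxiliary vertex
`x'` of Lemma 5.5. [cite: KozmaNachmias2011, proof of Lemma 5.5 (p. 401)] -/
def auxSet (K : ℕ) (x : Site d) (i : Fin d) (σ : ℤ) : Finset (Site d) :=
  (box d (auxRad K)).image fun w => x + Pi.single i (σ * ((K + auxRad K : ℕ) : ℤ)) + w

variable {K : ℕ} {x : Site d} {i : Fin d} {σ : ℤ}

/-- `2 · auxRad K ≤ K` for `K ≥ 2`, and `K ≤ 4 · auxRad K`. [cite: KozmaNachmias2011, proof of Lemma 5.5 (p. 401)] -/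
theorem auxRad_bounds (hK : 2 ≤ K) : 2 * auxRad K ≤ K ∧ K ≤ 4 * auxRad K := by
  unfold auxRad; omega

/-- Membership in the randomisation range. [cite: KozmaNachmias2011, proof of Lemma 5.5 (p. 401)] -/
theorem mem_auxSet {x' : Site d} :
    x' ∈ auxSet K x i σ ↔ ∃ w ∈ box d (auxRad K), x' = x + Pi.single i (σ * ((K + auxRad K : ℕ) : ℤ)) + w := by
  simp only [auxSet, Finset.mem_image]
  constructor
  · rintro ⟨w, hw, rfl⟩; exact ⟨w, hw, rfl⟩
  · rintro ⟨w, hw, rfl⟩; exact ⟨w, hw, rfl⟩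

/-- `|auxSet| = (2 auxRad K + 1)^d`. [cite: KozmaNachmias2011, Claim 5.4 (p. 401)] -/
theorem card_auxSet (K : ℕ) (x : Site d) (i : Fin d) (σ : ℤ) :
    #(auxSet K x i σ) = (2 * auxRad K + 1) ^ d := by
  unfold auxSet
  rw [Finset.card_image_of_injective _ (fun a b h => by simpa using h), card_box]

/-- `(K/2)^d ≤ |auxSet|`. [cite: KozmaNachmias2011, Claim 5.4 (p. 401)] -/
theorem half_pow_le_card_auxSet (K : ℕ) (x : Site d) (i : Fin d) (σ : ℤ) :
    ((K : ℝ) / 2) ^ d ≤ #(auxSet K x i σ) := by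
  rw [card_auxSet]
  push_cast
  refine pow_le_pow_left₀ (by positivity) ?_ d
  have : (K : ℝ) ≤ 4 * (auxRad K : ℕ) := by
    have h := (show K ≤ 4 * auxRad K by unfold auxRad; omega); exact_mod_cast h
  linarith

/-- A point of the randomisation range, shifted by `u ∈ Q_m`, lies in `x + Q_{K + 2 auxRad K + m}`
(coordinatewise). [cite: KozmaNachmias2011, proof of Lemma 5.5 ((5.10), p. 402: "x' + Q_s ⊂ x + Q_{2s}")] -/
theorem add_sub_mem_box_of_mem_auxSet (hσ : σ = 1 ∨ σ = -1) {x' : Site d} (hx' : x' ∈ auxSet K x i σ)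
    {m : ℕ} {u : Site d} (hu : u ∈ box d m) {R : ℕ} (hR : K + 2 * auxRad K + m ≤ R) :
    x' + u - x ∈ box d R := by
  obtain ⟨w, hw, rfl⟩ := mem_auxSet.1 hx'
  rw [mem_box] at hw hu ⊢
  intro k
  have h1 := hw k
  have h2 := hu k
  have hRz : ((K + 2 * auxRad K + m : ℕ) : ℤ) ≤ R := by exact_mod_cast hR
  simp only [Pi.add_apply, Pi.sub_apply]
  by_cases hk : k = i
  · subst hk
    simp only [Pi.single_eq_same]
    push_cast at hRz ⊢
    rcases hσ with rfl | rfl <;> constructor <;> nlinarith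
  · simp only [Pi.single_eq_of_ne hk]
    push_cast at hRz ⊢
    constructor <;> linarith

/-- Points of the randomisation range are within `2K` of `x` (`K ≥ 2`).
[cite: KozmaNachmias2011, proof of Lemma 5.5 (p. 401: x' ∈ x + Q_K)] -/
theorem norm_sub_le_of_mem_auxSet (hσ : σ = 1 ∨ σ = -1) (hK : 2 ≤ K) {x' : Site d}
    (hx' : x' ∈ auxSet K x i σ) : ‖x' - x‖ ≤ 2 * K := by
  have h := add_sub_mem_box_of_mem_auxSet hσ hx' (zero_mem_box d 0) (R := 2 * K)
    (by have := (auxRad_bounds hK).1; omega)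
  rw [add_zero, mem_box_iff_norm_le] at h
  exact_mod_cast h

/-- Points of the randomisation range are at sup-distance `≥ K` from `Q_j`, when `x` lies on the face
`x_i = σ j`. [cite: KozmaNachmias2011, proof of Lemma 5.5 (p. 401: x' ∉ Q_{j+K/2})] -/
theorem le_norm_sub_of_mem_auxSet (hσ : σ = 1 ∨ σ = -1) {j : ℕ} (hxi : x i = σ * j) {x' : Site d}
    (hx' : x' ∈ auxSet K x i σ) {z : Site d} (hz : z ∈ box d j) : (K : ℝ) ≤ ‖z - x'‖ := by
  obtain ⟨w, hw, hx'eq⟩ := mem_auxSet.1 hx'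
  rw [mem_box] at hw hz
  have h1 := hw i
  have h2 := hz i
  have hxi' : x' i = x i + σ * ((K + auxRad K : ℕ) : ℤ) + w i := by
    rw [hx'eq]; simp
  have hcoord : (K : ℤ) ≤ |(z - x') i| := by
    rw [Pi.sub_apply, hxi', hxi]
    push_cast
    rcases hσ with rfl | rfl
    · rw [abs_of_nonpos (by nlinarith)]; nlinarith
    · rw [abs_of_nonneg (by nlinarith)]; nlinarith
  have h3 : ((z - x') i).natAbs ≤ Site.supNorm (z - x') := Site.natAbs_le_supNorm _ i
  have h4 : (K : ℤ) ≤ (((z - x') i).natAbs : ℤ) := by rw [Int.natCast_natAbs]; exact hcoord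
  have h5 : K ≤ Site.supNorm (z - x') := le_trans (by exact_mod_cast h4) h3
  rw [Site.norm_eq_supNorm]
  exact_mod_cast h5

/-- The randomisation range is nonempty. [cite: KozmaNachmias2011, proof of Lemma 5.5 (p. 401)] -/
theorem auxSet_nonempty (K : ℕ) (x : Site d) (i : Fin d) (σ : ℤ) : (auxSet K x i σ).Nonempty :=
  ⟨_, mem_auxSet.2 ⟨0, zero_mem_box d _, rfl⟩⟩

end AuxSet

/-! ### The averaged error bound `E_{x'} Σ_y Σ_z P(E₁ ∩ {0 ↔ z}) τ(x',z) τ(z,y)` -/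

section ErrorBound

variable (p : unitInterval) (j K M : ℕ) (x : Site d)

/-- `shellWt t = 2^{d-2} · shellWt (t+1)`. [cite: KozmaNachmias2011, proof of Lemma 5.3 ((5.6), p. 400)] -/
theorem shellWt_eq_mul_succ (t : ℕ) :
    shellWt d t = (2 : ℝ) ^ (d - 2) * shellWt d (t + 1) := by
  unfold shellWt
  rw [pow_succ, mul_pow, mul_inv]
  have h2 : ((2 : ℝ) ^ (d - 2)) * ((2 : ℝ) ^ (d - 2))⁻¹ = 1 := mul_inv_cancel₀ (by positivity)
  calc (2 : ℝ) ^ (d - 2) * ((2 ^ t) ^ (d - 2))⁻¹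
      = (2 : ℝ) ^ (d - 2) * ((2 ^ t) ^ (d - 2))⁻¹ * (((2 : ℝ) ^ (d - 2)) * ((2 : ℝ) ^ (d - 2))⁻¹) := by
        rw [h2, mul_one]
    _ = _ := by ring

/-- **Large scales** (5.11)–(5.12): for `m ≥ K` and `x'` in the randomisation range,
`Σ_{u ∈ Q_m} P(E₁ ∩ {x ↔ x'+u}) ≤ ψ(4m) P(E₁)` (`x' + Q_m ⊆ x + Q_{4m}` and the regularity of `x`).
[cite: KozmaNachmias2011, proof of Lemma 5.5 ((5.11)–(5.12), pp. 402–403)] -/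
theorem sum_real_inter_openConn_shift_le_large {i : Fin d} {σ : ℤ} (hσ : σ = 1 ∨ σ = -1) (hK : 2 ≤ K)
    {x' : Site d} (hx' : x' ∈ auxSet K x i σ) {m : ℕ} (hm : K ≤ m) :
    ∑ u ∈ box d m, (bondPercolation (zdGraph d) p).real (eventE1 p j K M x ∩ openConn x (x' + u)) ≤
      psiKN d ((4 * m : ℕ) : ℝ) * (bondPercolation (zdGraph d) p).real (eventE1 p j K M x) := by
  classical
  have hR : K + 2 * auxRad K + m ≤ 4 * m := by have := (auxRad_bounds hK).1; omega
  calc ∑ u ∈ box d m, (bondPercolation (zdGraph d) p).real (eventE1 p j K M x ∩ openConn x (x' + u))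
      = ∑ v ∈ (box d m).image (fun u => x' + u - x),
          (bondPercolation (zdGraph d) p).real (eventE1 p j K M x ∩ openConn x (x + v)) := by
        rw [Finset.sum_image (fun a _ b _ h => by simpa using h)]
        refine Finset.sum_congr rfl fun u _ => by rw [add_sub_cancel]
    _ ≤ ∑ v ∈ box d (4 * m), (bondPercolation (zdGraph d) p).real (eventE1 p j K M x ∩ openConn x (x + v)) :=
        Finset.sum_le_sum_of_subset_of_nonneg
          (Finset.image_subset_iff.2 fun u hu => add_sub_mem_box_of_mem_auxSet hσ hx' hu hR)
          fun _ _ _ => measureReal_nonneg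
    _ ≤ _ := sum_real_eventE1_inter_openConn_le p j K M x (by omega)

/-- **Small scales, randomised** (Claim 5.4 and p. 403): for `m ≤ K` and `u ∈ Q_m`,
`Σ_{x' ∈ auxSet} P(E₁ ∩ {x ↔ x'+u}) ≤ ψ(4K) P(E₁)` (the map `x' ↦ x' + u` is injective into
`x + Q_{4K}`). [cite: KozmaNachmias2011, Claim 5.4 and proof of Lemma 5.5 (p. 403)] -/
theorem sum_auxSet_real_inter_openConn_le_small {i : Fin d} {σ : ℤ} (hσ : σ = 1 ∨ σ = -1) (hK : 2 ≤ K)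
    {m : ℕ} (hm : m ≤ K) {u : Site d} (hu : u ∈ box d m) :
    ∑ x' ∈ auxSet K x i σ, (bondPercolation (zdGraph d) p).real (eventE1 p j K M x ∩ openConn x (x' + u)) ≤
      psiKN d ((4 * K : ℕ) : ℝ) * (bondPercolation (zdGraph d) p).real (eventE1 p j K M x) := by
  classical
  have hR : K + 2 * auxRad K + m ≤ 4 * K := by have := (auxRad_bounds hK).1; omega
  calc ∑ x' ∈ auxSet K x i σ, (bondPercolation (zdGraph d) p).real (eventE1 p j K M x ∩ openConn x (x' + u))
      = ∑ v ∈ (auxSet K x i σ).image (fun x' => x' + u - x),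
          (bondPercolation (zdGraph d) p).real (eventE1 p j K M x ∩ openConn x (x + v)) := by
        rw [Finset.sum_image (fun a _ b _ h => by simpa using h)]
        refine Finset.sum_congr rfl fun x' _ => by rw [add_sub_cancel]
    _ ≤ ∑ v ∈ box d (4 * K), (bondPercolation (zdGraph d) p).real (eventE1 p j K M x ∩ openConn x (x + v)) :=
        Finset.sum_le_sum_of_subset_of_nonneg
          (Finset.image_subset_iff.2 fun x' hx' => add_sub_mem_box_of_mem_auxSet hσ hx' hu hR)
          fun _ _ _ => measureReal_nonneg
    _ ≤ _ := sum_real_eventE1_inter_openConn_le p j K M x (by omega)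

/-- **Dyadic regrouping around `x'`** ((5.10), p. 402): for a finite set `Z` of branch points,
`Σ_{z ∈ Z} P(E₁ ∩ {x ↔ z}) |z - x'|^{2-d} ≤ Σ_{t ≤ T} shellWt t · Σ_{u ∈ Q_{2^t}} P(E₁ ∩ {x ↔ x'+u})`.
[cite: KozmaNachmias2011, proof of Lemma 5.5 ((5.10), p. 402)] -/
theorem sum_real_inter_mul_twoPtWt_le_dyadic (hd : 2 ≤ d) (x' : Site d) (Z : Finset (Site d)) {T : ℕ}
    (hT : ∀ z ∈ Z, dyadicScale x' z ≤ T) :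
    ∑ z ∈ Z, (bondPercolation (zdGraph d) p).real (eventE1 p j K M x ∩ openConn x z) * twoPtWt d x' z ≤
      ∑ t ∈ Finset.range (T + 1), shellWt d t *
        ∑ u ∈ box d (2 ^ t), (bondPercolation (zdGraph d) p).real (eventE1 p j K M x ∩ openConn x (x' + u)) := by
  classical
  set f : Site d → ℝ := fun z => (bondPercolation (zdGraph d) p).real (eventE1 p j K M x ∩ openConn x z) with hf
  have hf0 : ∀ z, 0 ≤ f z := fun z => measureReal_nonneg
  calc ∑ z ∈ Z, f z * twoPtWt d x' z
      ≤ ∑ z ∈ Z, f z * shellWt d (dyadicScale x' z) :=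
        Finset.sum_le_sum fun z _ => mul_le_mul_of_nonneg_left (twoPtWt_le_shellWt hd x' z) (hf0 z)
    _ = ∑ t ∈ Finset.range (T + 1), ∑ z ∈ Z.filter (fun z => dyadicScale x' z = t), f z * shellWt d (dyadicScale x' z) := by
        rw [Finset.sum_fiberwise_of_maps_to]
        intro z hz
        exact Finset.mem_range.2 (Nat.lt_succ_of_le (hT z hz))
    _ = ∑ t ∈ Finset.range (T + 1), shellWt d t * ∑ z ∈ Z.filter (fun z => dyadicScale x' z = t), f z := by
        refine Finset.sum_congr rfl fun t _ => ?_
        rw [Finset.mul_sum]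
        refine Finset.sum_congr rfl fun z hz => ?_
        rw [(Finset.mem_filter.1 hz).2, mul_comm]
    _ ≤ ∑ t ∈ Finset.range (T + 1), shellWt d t * ∑ u ∈ box d (2 ^ t), f (x' + u) := by
        refine Finset.sum_le_sum fun t _ => mul_le_mul_of_nonneg_left ?_ (shellWt_nonneg d t)
        calc ∑ z ∈ Z.filter (fun z => dyadicScale x' z = t), f z
            = ∑ u ∈ (Z.filter (fun z => dyadicScale x' z = t)).image (fun z => z - x'), f (x' + u) := by
              rw [Finset.sum_image (fun a _ b _ h => by simpa using h)]
              refine Finset.sum_congr rfl fun z _ => by rw [add_sub_cancel]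
          _ ≤ ∑ u ∈ box d (2 ^ t), f (x' + u) := by
              refine Finset.sum_le_sum_of_subset_of_nonneg (Finset.image_subset_iff.2 fun z hz => ?_)
                fun _ _ _ => hf0 _
              rw [mem_box_iff_supNorm_le]
              have h := supNorm_le_two_pow_dyadicScale x' z
              rwa [(Finset.mem_filter.1 hz).2] at h

/-- **Per-`x'` bound** ((5.10)–(5.12)): for `x'` in the randomisation range and `K` so large that the
tail over the scales `2^t ≥ K` is `≤ δ_L` (`tail_large`), for every finite set `Z` of branch points
`Σ_{z ∈ Z} P(E₁ ∩ {x ↔ z}) |z-x'|^{2-d} ≤ 2^{d-2} δ_L P(E₁) + Σ_{t : 2^t < K} shellWt t Σ_{u ∈ Q_{2^t}} P(E₁ ∩ {x ↔ x'+u})`.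
[cite: KozmaNachmias2011, proof of Lemma 5.5 ((5.10)–(5.12), pp. 402–403)] -/
theorem sum_real_inter_mul_twoPtWt_le_of_mem_auxSet (hd : 2 ≤ d) {i : Fin d} {σ : ℤ} (hσ : σ = 1 ∨ σ = -1)
    (hK : 2 ≤ K) {δL : ℝ}
    (hKL : ∀ S : Finset ℕ, (∀ t ∈ S, (K : ℝ) ≤ (2 : ℝ) ^ t) →
      ∑ t ∈ S, shellWt d t * psiKN d ((2 : ℝ) ^ (t + 1)) ≤ δL)
    {x' : Site d} (hx' : x' ∈ auxSet K x i σ) (Z : Finset (Site d)) :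
    ∑ z ∈ Z, (bondPercolation (zdGraph d) p).real (eventE1 p j K M x ∩ openConn x z) * twoPtWt d x' z ≤
      (2 : ℝ) ^ (d - 2) * δL * (bondPercolation (zdGraph d) p).real (eventE1 p j K M x) +
        ∑ t ∈ (Finset.range K).filter (fun t => 2 ^ t < K), shellWt d t *
          ∑ u ∈ box d (2 ^ t), (bondPercolation (zdGraph d) p).real (eventE1 p j K M x ∩ openConn x (x' + u)) := by
  classical
  set μ := bondPercolation (zdGraph d) p with hμ
  set PE := μ.real (eventE1 p j K M x) with hPE
  have hPE0 : 0 ≤ PE := measureReal_nonneg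
  set S : ℕ → ℝ := fun t => ∑ u ∈ box d (2 ^ t), μ.real (eventE1 p j K M x ∩ openConn x (x' + u)) with hS
  have hS0 : ∀ t, 0 ≤ S t := fun t => Finset.sum_nonneg fun _ _ => measureReal_nonneg
  obtain ⟨T, hT⟩ := exists_dyadicScale_le x' Z
  have h1 := sum_real_inter_mul_twoPtWt_le_dyadic p j K M x hd x' Z hT
  set Tl : Finset ℕ := (Finset.range (T + 1)).filter fun t => K ≤ 2 ^ t with hTl
  set Ts : Finset ℕ := (Finset.range (T + 1)).filter fun t => ¬K ≤ 2 ^ t with hTs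
  have hsplit : ∑ t ∈ Finset.range (T + 1), shellWt d t * S t =
      ∑ t ∈ Tl, shellWt d t * S t + ∑ t ∈ Ts, shellWt d t * S t :=
    (Finset.sum_filter_add_sum_filter_not _ (fun t => K ≤ 2 ^ t) _).symm
  -- large scales
  have hlarge : ∑ t ∈ Tl, shellWt d t * S t ≤ (2 : ℝ) ^ (d - 2) * δL * PE := by
    have hle : ∀ t ∈ Tl, shellWt d t * S t ≤
        ((2 : ℝ) ^ (d - 2) * (shellWt d (t + 1) * psiKN d ((2 : ℝ) ^ (t + 1 + 1)))) * PE := by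
      intro t ht
      have hKt : K ≤ 2 ^ t := (Finset.mem_filter.1 ht).2
      have h := sum_real_inter_openConn_shift_le_large p j K M x hσ hK hx' hKt
      have hcast : ((4 * 2 ^ t : ℕ) : ℝ) = (2 : ℝ) ^ (t + 1 + 1) := by push_cast; ring
      rw [hcast] at h
      calc shellWt d t * S t ≤ shellWt d t * (psiKN d ((2 : ℝ) ^ (t + 1 + 1)) * PE) :=
            mul_le_mul_of_nonneg_left h (shellWt_nonneg d t)
        _ = ((2 : ℝ) ^ (d - 2) * (shellWt d (t + 1) * psiKN d ((2 : ℝ) ^ (t + 1 + 1)))) * PE := by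
            rw [shellWt_eq_mul_succ t]; ring
    have hmap : ∑ t ∈ Tl, shellWt d (t + 1) * psiKN d ((2 : ℝ) ^ (t + 1 + 1)) =
        ∑ u ∈ Tl.map ⟨Nat.succ, Nat.succ_injective⟩, shellWt d u * psiKN d ((2 : ℝ) ^ (u + 1)) := by
      rw [Finset.sum_map]; rfl
    have htail : ∑ u ∈ Tl.map ⟨Nat.succ, Nat.succ_injective⟩, shellWt d u * psiKN d ((2 : ℝ) ^ (u + 1)) ≤ δL := by
      refine hKL _ fun u hu => ?_
      rw [Finset.mem_map] at hu
      obtain ⟨t, ht, rfl⟩ := hu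
      have hKt : K ≤ 2 ^ t := (Finset.mem_filter.1 ht).2
      have : (K : ℝ) ≤ (2 : ℝ) ^ t := by exact_mod_cast hKt
      simp only [Function.Embedding.coeFn_mk, Nat.succ_eq_add_one, pow_succ]
      linarith [pow_nonneg (show (0 : ℝ) ≤ 2 by norm_num) t]
    calc ∑ t ∈ Tl, shellWt d t * S t
        ≤ ∑ t ∈ Tl, ((2 : ℝ) ^ (d - 2) * (shellWt d (t + 1) * psiKN d ((2 : ℝ) ^ (t + 1 + 1)))) * PE :=
          Finset.sum_le_sum hle
      _ = (2 : ℝ) ^ (d - 2) * (∑ t ∈ Tl, shellWt d (t + 1) * psiKN d ((2 : ℝ) ^ (t + 1 + 1))) * PE := by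
          rw [Finset.mul_sum, Finset.sum_mul]
      _ ≤ (2 : ℝ) ^ (d - 2) * δL * PE := by
          rw [hmap]
          exact mul_le_mul_of_nonneg_right (mul_le_mul_of_nonneg_left htail (by positivity)) hPE0
  -- small scales: enlarge the index set
  have hsmall : ∑ t ∈ Ts, shellWt d t * S t ≤
      ∑ t ∈ (Finset.range K).filter (fun t => 2 ^ t < K), shellWt d t * S t := by
    refine Finset.sum_le_sum_of_subset_of_nonneg (fun t ht => ?_) fun t _ _ => mul_nonneg (shellWt_nonneg d t) (hS0 t)
    rw [Finset.mem_filter] at ht ⊢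
    have hlt : 2 ^ t < K := not_le.1 ht.2
    exact ⟨Finset.mem_range.2 (lt_of_lt_of_le (Nat.lt_two_pow_self) hlt.le), hlt⟩
  calc _ ≤ ∑ t ∈ Finset.range (T + 1), shellWt d t * S t := h1
    _ = ∑ t ∈ Tl, shellWt d t * S t + ∑ t ∈ Ts, shellWt d t * S t := hsplit
    _ ≤ _ := add_le_add hlarge hsmall

/-- **The averaged dyadic sum** (pp. 402–403): for `δ_L, δ_S > 0` and `K` large, for every finite set
`Z` of branch points,
`Σ_{x' ∈ auxSet} Σ_{z ∈ Z} P(E₁ ∩ {x ↔ z}) |z - x'|^{2-d} ≤ (2^{d-2} δ_L + δ_S) |auxSet| P(E₁)`.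
[cite: KozmaNachmias2011, proof of Lemma 5.5 ((5.10)–(5.12) and the display after (5.12), p. 403)] -/
theorem sum_auxSet_sum_real_inter_mul_twoPtWt_le (hd : 7 ≤ d) {δL δS : ℝ} (hδL : 0 < δL) (hδS : 0 < δS) :
    ∃ K₀ : ℕ, ∀ K : ℕ, K₀ ≤ K → ∀ (j M : ℕ) (x : Site d) (i : Fin d) (σ : ℤ), σ = 1 ∨ σ = -1 →
      ∀ Z : Finset (Site d),
      ∑ x' ∈ auxSet K x i σ, ∑ z ∈ Z,
          (bondPercolation (zdGraph d) (criticalProbI d)).real (eventE1 (criticalProbI d) j K M x ∩ openConn x z) *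
            twoPtWt d x' z ≤
        ((2 : ℝ) ^ (d - 2) * δL + δS) * #(auxSet K x i σ) *
          (bondPercolation (zdGraph d) (criticalProbI d)).real (eventE1 (criticalProbI d) j K M x) := by
  classical
  have hd2 : 2 ≤ d := by omega
  obtain ⟨KL, hKL⟩ := tail_large hd hδL
  obtain ⟨KS, hKS⟩ := tail_small hd hδS
  refine ⟨max (max KL KS) 2, fun K hK j M x i σ hσ Z => ?_⟩
  have hKL' : KL ≤ K := le_trans (le_trans (le_max_left _ _) (le_max_left _ _)) hK
  have hKS' : KS ≤ 2 * K := le_trans (le_trans (le_max_right _ _) (le_max_left _ _)) (hK.trans (Nat.le_mul_of_pos_left K two_pos))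
  have hK2 : 2 ≤ K := le_trans (le_max_right _ _) hK
  have hK0 : (0 : ℝ) < K := by exact_mod_cast (show 0 < K by omega)
  set p := criticalProbI d with hp
  set μ := bondPercolation (zdGraph d) p with hμ
  set PE := μ.real (eventE1 p j K M x) with hPE
  have hPE0 : 0 ≤ PE := measureReal_nonneg
  set R := auxSet K x i σ with hR
  set Tsm : Finset ℕ := (Finset.range K).filter (fun t => 2 ^ t < K) with hTsm
  -- per `x'`
  have hper : ∀ x' ∈ R, ∑ z ∈ Z, μ.real (eventE1 p j K M x ∩ openConn x z) * twoPtWt d x' z ≤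
      (2 : ℝ) ^ (d - 2) * δL * PE +
        ∑ t ∈ Tsm, shellWt d t * ∑ u ∈ box d (2 ^ t), μ.real (eventE1 p j K M x ∩ openConn x (x' + u)) :=
    fun x' hx' => sum_real_inter_mul_twoPtWt_le_of_mem_auxSet p j K M x hd2 hσ hK2 (hKL K hKL') hx' Z
  -- the randomised small scales
  have hsm : ∑ x' ∈ R, ∑ t ∈ Tsm, shellWt d t *
      ∑ u ∈ box d (2 ^ t), μ.real (eventE1 p j K M x ∩ openConn x (x' + u)) ≤ δS * #R * PE := by
    rw [Finset.sum_comm]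
    have h1 : ∀ t ∈ Tsm, ∑ x' ∈ R, shellWt d t *
        ∑ u ∈ box d (2 ^ t), μ.real (eventE1 p j K M x ∩ openConn x (x' + u)) ≤
        shellWt d t * (2 * (2 : ℝ) ^ t + 1) ^ d * (psiKN d ((4 * K : ℕ) : ℝ) * PE) := by
      intro t ht
      have htK : 2 ^ t ≤ K := (Finset.mem_filter.1 ht).2.le
      rw [← Finset.mul_sum, Finset.sum_comm, mul_assoc]
      refine mul_le_mul_of_nonneg_left ?_ (shellWt_nonneg d t)
      calc ∑ u ∈ box d (2 ^ t), ∑ x' ∈ R, μ.real (eventE1 p j K M x ∩ openConn x (x' + u))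
          ≤ ∑ _u ∈ box d (2 ^ t), psiKN d ((4 * K : ℕ) : ℝ) * PE :=
            Finset.sum_le_sum fun u hu => sum_auxSet_real_inter_openConn_le_small p j K M x hσ hK2 htK hu
        _ = (2 * (2 : ℝ) ^ t + 1) ^ d * (psiKN d ((4 * K : ℕ) : ℝ) * PE) := by
            rw [Finset.sum_const, nsmul_eq_mul, card_box]; push_cast; ring
    have h2 := hKS (2 * K) hKS' Tsm fun t ht => by
      have : 2 ^ t < K := (Finset.mem_filter.1 ht).2
      have : ((2 ^ t : ℕ) : ℝ) < ((2 * K : ℕ) : ℝ) := by exact_mod_cast (by omega : 2 ^ t < 2 * K)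
      push_cast at this ⊢
      linarith
    have hcast : ((2 * (2 * K) : ℕ) : ℝ) = ((4 * K : ℕ) : ℝ) := by push_cast; ring
    rw [hcast] at h2
    have hden : (0 : ℝ) < (((2 * K : ℕ) : ℝ) / 4) ^ d := by positivity
    rw [div_le_iff₀ hden] at h2
    have hden' : (((2 * K : ℕ) : ℝ) / 4) ^ d ≤ #R := by
      have : ((2 * K : ℕ) : ℝ) / 4 = (K : ℝ) / 2 := by push_cast; ring
      rw [this]; exact half_pow_le_card_auxSet K x i σ
    calc ∑ t ∈ Tsm, ∑ x' ∈ R, shellWt d t * ∑ u ∈ box d (2 ^ t), μ.real (eventE1 p j K M x ∩ openConn x (x' + u))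
        ≤ ∑ t ∈ Tsm, shellWt d t * (2 * (2 : ℝ) ^ t + 1) ^ d * (psiKN d ((4 * K : ℕ) : ℝ) * PE) :=
          Finset.sum_le_sum h1
      _ = (∑ t ∈ Tsm, shellWt d t * (2 * (2 : ℝ) ^ t + 1) ^ d) * psiKN d ((4 * K : ℕ) : ℝ) * PE := by
          rw [Finset.sum_mul, Finset.sum_mul]; refine Finset.sum_congr rfl fun t _ => by ring
      _ ≤ δS * (((2 * K : ℕ) : ℝ) / 4) ^ d * PE := mul_le_mul_of_nonneg_right h2 hPE0
      _ ≤ δS * #R * PE := mul_le_mul_of_nonneg_right (mul_le_mul_of_nonneg_left hden' hδS.le) hPE0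
  calc ∑ x' ∈ R, ∑ z ∈ Z, μ.real (eventE1 p j K M x ∩ openConn x z) * twoPtWt d x' z
      ≤ ∑ x' ∈ R, ((2 : ℝ) ^ (d - 2) * δL * PE +
          ∑ t ∈ Tsm, shellWt d t * ∑ u ∈ box d (2 ^ t), μ.real (eventE1 p j K M x ∩ openConn x (x' + u))) :=
        Finset.sum_le_sum hper
    _ = #R * ((2 : ℝ) ^ (d - 2) * δL * PE) + ∑ x' ∈ R, ∑ t ∈ Tsm, shellWt d t *
          ∑ u ∈ box d (2 ^ t), μ.real (eventE1 p j K M x ∩ openConn x (x' + u)) := by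
        rw [Finset.sum_add_distrib, Finset.sum_const, nsmul_eq_mul]
    _ ≤ #R * ((2 : ℝ) ^ (d - 2) * δL * PE) + δS * #R * PE := by linarith [hsm]
    _ = ((2 : ℝ) ^ (d - 2) * δL + δS) * #R * PE := by ring

/-- **The averaged error bound** (Kozma–Nachmias 2011, p. 403: "`E_{x'} Σ_{y ∈ x+Q_L} P(E₁ ∩ E₂ ∩ ¬E₃)
≤ C L² P(E₁) K^{6-d} log⁷ K`", here through the truncated BK–Reimer sums): for every `δ > 0`, for
`K ≥ K₀(δ)`, uniformly in the truncation `N`,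
`Σ_{x' ∈ auxSet} Σ_{w ∈ Q_L} Σ_{z ∈ Λ_N} P(E₁ ∩ {0 ↔ z}) τ(x',z) τ(z, x+w) ≤ δ L² |auxSet| P(E₁)`.
[cite: KozmaNachmias2011, proof of Lemma 5.5 ((5.9)–(5.12), pp. 402–403)] -/
theorem sum_bkr_error_le (hd : 6 < d) (hτ : TwoPointBoundedRatio d) {δ : ℝ} (hδ : 0 < δ) :
    ∃ K₀ : ℕ, ∀ K : ℕ, K₀ ≤ K → ∀ (j M L : ℕ) (x : Site d) (i : Fin d) (σ : ℤ), σ = 1 ∨ σ = -1 → 1 ≤ L →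
      ∀ N : ℕ,
      ∑ x' ∈ auxSet K x i σ, ∑ w ∈ box d L, ∑ z ∈ box d N,
          (bondPercolation (zdGraph d) (criticalProbI d)).real
              (eventE1 (criticalProbI d) j K M x ∩ openConn (0 : Site d) z) *
            (tau d (criticalProbI d) x' z * tau d (criticalProbI d) z (x + w)) ≤
        δ * (L : ℝ) ^ 2 * #(auxSet K x i σ) *
          (bondPercolation (zdGraph d) (criticalProbI d)).real (eventE1 (criticalProbI d) j K M x) := by
  classical
  have hd2 : 2 ≤ d := by omega
  have hd7 : 7 ≤ d := hd
  set p := criticalProbI d with hp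
  obtain ⟨C', C, hC', hC'C, hb⟩ := hτ.natPow hd2
  have hC : 0 ≤ C := hC'.le.trans hC'C
  obtain ⟨C₀, hC₀, hbox⟩ := exists_sum_tau_box_le p hd2 hC fun x y hxy => (hb x y hxy).2
  have hA : 0 < max C 1 := lt_max_of_lt_right one_pos
  obtain ⟨K₀, hK₀⟩ := sum_auxSet_sum_real_inter_mul_twoPtWt_le (d := d) hd7
    (δL := δ / (2 * C₀ * max C 1 * (2 : ℝ) ^ (d - 2))) (δS := δ / (2 * C₀ * max C 1))
    (by positivity) (by positivity)
  refine ⟨K₀, fun K hK j M L x i σ hσ hL N => ?_⟩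
  set μ := bondPercolation (zdGraph d) p with hμ
  set PE := μ.real (eventE1 p j K M x) with hPE
  set R := auxSet K x i σ with hR
  have hcore := hK₀ K hK j M x i σ hσ (box d N)
  have hconst : ((2 : ℝ) ^ (d - 2) * (δ / (2 * C₀ * max C 1 * (2 : ℝ) ^ (d - 2))) +
      δ / (2 * C₀ * max C 1)) = δ / (C₀ * max C 1) := by
    field_simp; ring
  rw [hconst] at hcore
  -- the `w`-sum and the two-point weight
  have hstep : ∀ x' ∈ R, ∑ w ∈ box d L, ∑ z ∈ box d N,
      μ.real (eventE1 p j K M x ∩ openConn (0 : Site d) z) * (tau d p x' z * tau d p z (x + w)) ≤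
      C₀ * (L : ℝ) ^ 2 * max C 1 *
        ∑ z ∈ box d N, μ.real (eventE1 p j K M x ∩ openConn x z) * twoPtWt d x' z := by
    intro x' _
    rw [Finset.sum_comm, Finset.mul_sum]
    refine Finset.sum_le_sum fun z _ => ?_
    rw [eventE1_inter_openConn_zero_eq]
    have hμz : 0 ≤ μ.real (eventE1 p j K M x ∩ openConn x z) := measureReal_nonneg
    calc ∑ w ∈ box d L, μ.real (eventE1 p j K M x ∩ openConn x z) * (tau d p x' z * tau d p z (x + w))
        = μ.real (eventE1 p j K M x ∩ openConn x z) * tau d p x' z * ∑ w ∈ box d L, tau d p z (x + w) := by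
          rw [Finset.mul_sum]; refine Finset.sum_congr rfl fun w _ => by ring
      _ ≤ μ.real (eventE1 p j K M x ∩ openConn x z) * (max C 1 * twoPtWt d x' z) * (C₀ * (L : ℝ) ^ 2) :=
          mul_le_mul (mul_le_mul_of_nonneg_left (tau_le_mul_twoPtWt p (fun a b hab => (hb a b hab).2) x' z) hμz)
            (hbox z x L hL) (Finset.sum_nonneg fun _ _ => tau_nonneg p _ _)
            (mul_nonneg hμz (mul_nonneg hA.le (twoPtWt_nonneg _ _)))
      _ = C₀ * (L : ℝ) ^ 2 * max C 1 * (μ.real (eventE1 p j K M x ∩ openConn x z) * twoPtWt d x' z) := by ring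
  calc ∑ x' ∈ R, ∑ w ∈ box d L, ∑ z ∈ box d N,
        μ.real (eventE1 p j K M x ∩ openConn (0 : Site d) z) * (tau d p x' z * tau d p z (x + w))
      ≤ ∑ x' ∈ R, C₀ * (L : ℝ) ^ 2 * max C 1 *
          ∑ z ∈ box d N, μ.real (eventE1 p j K M x ∩ openConn x z) * twoPtWt d x' z := Finset.sum_le_sum hstep
    _ = C₀ * (L : ℝ) ^ 2 * max C 1 *
          ∑ x' ∈ R, ∑ z ∈ box d N, μ.real (eventE1 p j K M x ∩ openConn x z) * twoPtWt d x' z := by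
        rw [Finset.mul_sum]
    _ ≤ C₀ * (L : ℝ) ^ 2 * max C 1 * (δ / (C₀ * max C 1) * #R * PE) :=
        mul_le_mul_of_nonneg_left hcore (by positivity)
    _ = δ * (L : ℝ) ^ 2 * #R * PE := by field_simp

end ErrorBound

/-! ### Lemma 5.5 -/

section Lemma55

/-- **Kozma–Nachmias 2011, Lemma 5.5, PROVED** (p. 401) at `p = p_c` on `ℤ^d`, `d > 6`, under the
two-point estimate `TwoPointBoundedRatio d`: there are `c > 0` and `K₀` such that for `K ≥ K₀`, every
`x ∈ ∂Q_j` lying on the face `x_i = σ j` (`σ = ±1`), every `M` and every `L ≥ 2K`, SOME `x'` in the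
randomisation range `auxSet K x i σ` satisfies
`Σ_{y ∈ (x + Q_L) ∖ Q_j} P(E₁(x,M,K) ∩ E₂(x,x',y) ∩ E₃(x,x')) ≥ c L² P(E₁(x,M,K))`
(Lemma 5.3 for every `x'` of the range, minus the averaged error bound, and an averaging argument).
[cite: KozmaNachmias2011, Lemma 5.5 (p. 401) and its proof (pp. 401–403)] -/
theorem KozmaNachmias2011_lemma55 (hd : 6 < d) (hτ : TwoPointBoundedRatio d) :
    ∃ c : ℝ, 0 < c ∧ ∃ K₀ : ℕ, ∀ K : ℕ, K₀ ≤ K → ∀ (j M L : ℕ) (x : Site d) (i : Fin d) (σ : ℤ),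
      σ = 1 ∨ σ = -1 → x ∈ sphere d j → x i = σ * j → 2 * K ≤ L →
      ∃ x' ∈ auxSet K x i σ,
        c * (L : ℝ) ^ 2 *
            (bondPercolation (zdGraph d) (criticalProbI d)).real (eventE1 (criticalProbI d) j K M x) ≤
          ∑ w ∈ (box d L).filter (fun w => x + w ∉ box d j),
            (bondPercolation (zdGraph d) (criticalProbI d)).real
              (eventE1 (criticalProbI d) j K M x ∩ eventE2 j x x' (x + w) ∩ eventE3 x x') := by
  classical
  obtain ⟨c₃, hc₃, K₃, h53⟩ := KozmaNachmias2011_lemma53 hd hτ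
  obtain ⟨K₅, herr⟩ := sum_bkr_error_le hd hτ (δ := c₃ / 2) (by positivity)
  refine ⟨c₃ / 2, by positivity, max (max K₃ K₅) 2, fun K hK j M L x i σ hσ hx hxi hKL => ?_⟩
  have hK3 : K₃ ≤ K := le_trans (le_trans (le_max_left _ _) (le_max_left _ _)) hK
  have hK5 : K₅ ≤ K := le_trans (le_trans (le_max_right _ _) (le_max_left _ _)) hK
  have hK2 : 2 ≤ K := le_trans (le_max_right _ _) hK
  have hL1 : 1 ≤ L := by omega
  set p := criticalProbI d with hp
  set μ := bondPercolation (zdGraph d) p with hμ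
  set PE := μ.real (eventE1 p j K M x) with hPE
  set R := auxSet K x i σ with hR
  set W := (box d L).filter (fun w => x + w ∉ box d j) with hW
  -- the truncated error sums and their suprema
  set a : Site d → Site d → ℕ → ℝ := fun x' w N => ∑ z ∈ box d N,
    μ.real (eventE1 p j K M x ∩ openConn (0 : Site d) z) * (tau d p x' z * tau d p z (x + w)) with ha
  have ha0 : ∀ x' w N, 0 ≤ a x' w N := fun x' w N =>
    Finset.sum_nonneg fun z _ => mul_nonneg measureReal_nonneg (mul_nonneg (tau_nonneg p _ _) (tau_nonneg p _ _))
  have hamono : ∀ x' w, Monotone (a x' w) := fun x' w N N' h =>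
    Finset.sum_le_sum_of_subset_of_nonneg (box_mono d h) fun z _ _ =>
      mul_nonneg measureReal_nonneg (mul_nonneg (tau_nonneg p _ _) (tau_nonneg p _ _))
  set Btot : ℝ := c₃ / 2 * (L : ℝ) ^ 2 * #R * PE with hBtot
  have htot : ∀ N, ∑ x' ∈ R, ∑ w ∈ W, a x' w N ≤ Btot := by
    intro N
    calc ∑ x' ∈ R, ∑ w ∈ W, a x' w N ≤ ∑ x' ∈ R, ∑ w ∈ box d L, a x' w N :=
          Finset.sum_le_sum fun x' _ => Finset.sum_le_sum_of_subset_of_nonneg (Finset.filter_subset _ _)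
            fun w _ _ => ha0 x' w N
      _ ≤ Btot := herr K hK5 j M L x i σ hσ hL1 N
  have hsingle : ∀ x' ∈ R, ∀ w ∈ W, ∀ N, a x' w N ≤ Btot := by
    intro x' hx' w hw N
    calc a x' w N ≤ ∑ w' ∈ W, a x' w' N := Finset.single_le_sum (fun w' _ => ha0 x' w' N) hw
      _ ≤ ∑ x'' ∈ R, ∑ w' ∈ W, a x'' w' N :=
          Finset.single_le_sum (f := fun x'' => ∑ w' ∈ W, a x'' w' N)
            (fun x'' _ => Finset.sum_nonneg fun w' _ => ha0 x'' w' N) hx'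
      _ ≤ Btot := htot N
  have hbdd : ∀ x' ∈ R, ∀ w ∈ W, BddAbove (Set.range (a x' w)) := fun x' hx' w hw =>
    ⟨Btot, by rintro _ ⟨N, rfl⟩; exact hsingle x' hx' w hw N⟩
  -- `P(E₁ ∩ E₂ ∩ ¬E₃) ≤ sup_N a`, and the sum of the suprema is at most `Btot`
  have hE3c : ∀ x' ∈ R, ∀ w ∈ W,
      μ.real (eventE1 p j K M x ∩ eventE2 j x x' (x + w) ∩ (eventE3 x x')ᶜ) ≤ ⨆ N, a x' w N :=
    fun x' hx' w hw => real_eventE1_inter_eventE2_inter_compl_eventE3_le p j K M x x' (x + w)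
      fun N => le_ciSup (hbdd x' hx' w hw) N
  have hsupsum : ∑ x' ∈ R, ∑ w ∈ W, (⨆ N, a x' w N) ≤ Btot := by
    have hlim : Tendsto (fun N => ∑ x' ∈ R, ∑ w ∈ W, a x' w N) atTop (𝓝 (∑ x' ∈ R, ∑ w ∈ W, ⨆ N, a x' w N)) := by
      refine tendsto_finsetSum _ fun x' hx' => tendsto_finsetSum _ fun w hw => ?_
      exact tendsto_atTop_ciSup (hamono x' w) (hbdd x' hx' w hw)
    exact le_of_tendsto' hlim htot
  -- Lemma 5.3 for every `x'` of the range
  have h53' : ∀ x' ∈ R, c₃ * (L : ℝ) ^ 2 * PE ≤ ∑ w ∈ W, μ.real (eventE1 p j K M x ∩ eventE2 j x x' (x + w)) :=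
    fun x' hx' => h53 K hK3 j M L x x' hx (norm_sub_le_of_mem_auxSet hσ hK2 hx')
      (fun z hz => le_norm_sub_of_mem_auxSet hσ hxi hx' hz) hKL
  -- averaging
  have hsum : ∑ x' ∈ R, (c₃ / 2 * (L : ℝ) ^ 2 * PE) ≤
      ∑ x' ∈ R, ∑ w ∈ W, μ.real (eventE1 p j K M x ∩ eventE2 j x x' (x + w) ∩ eventE3 x x') := by
    have hsplit : ∀ x' ∈ R, ∀ w ∈ W, μ.real (eventE1 p j K M x ∩ eventE2 j x x' (x + w)) ≤
        μ.real (eventE1 p j K M x ∩ eventE2 j x x' (x + w) ∩ eventE3 x x') +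
          μ.real (eventE1 p j K M x ∩ eventE2 j x x' (x + w) ∩ (eventE3 x x')ᶜ) := by
      intro x' _ w _
      refine (measureReal_mono (fun ω hω => ?_) (measure_ne_top _ _)).trans (measureReal_union_le _ _)
      by_cases h3 : ω ∈ eventE3 x x'
      · exact Or.inl ⟨hω, h3⟩
      · exact Or.inr ⟨hω, h3⟩
    have h1 : ∑ x' ∈ R, c₃ * (L : ℝ) ^ 2 * PE ≤
        ∑ x' ∈ R, ∑ w ∈ W, (μ.real (eventE1 p j K M x ∩ eventE2 j x x' (x + w) ∩ eventE3 x x') +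
          μ.real (eventE1 p j K M x ∩ eventE2 j x x' (x + w) ∩ (eventE3 x x')ᶜ)) :=
      Finset.sum_le_sum fun x' hx' => (h53' x' hx').trans (Finset.sum_le_sum fun w hw => hsplit x' hx' w hw)
    have h2 : ∑ x' ∈ R, ∑ w ∈ W, μ.real (eventE1 p j K M x ∩ eventE2 j x x' (x + w) ∩ (eventE3 x x')ᶜ) ≤ Btot :=
      (Finset.sum_le_sum fun x' hx' => Finset.sum_le_sum fun w hw => hE3c x' hx' w hw).trans hsupsum
    have h3 : ∑ x' ∈ R, (c₃ / 2 * (L : ℝ) ^ 2 * PE) = ∑ x' ∈ R, c₃ * (L : ℝ) ^ 2 * PE - Btot := by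
      rw [Finset.sum_const, Finset.sum_const, nsmul_eq_mul, nsmul_eq_mul, hBtot]; ring
    rw [h3]
    have h4 := h1
    simp only [Finset.sum_add_distrib] at h4
    linarith
  exact Finset.exists_le_of_sum_le (auxSet_nonempty K x i σ) hsum

end Lemma55



end Literature.Barriers.CriticalPhenomena

end
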